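import Summits.ABC.IUTFork.LDHGenuinePerImageContentfulTame
import HarnessLib

/-!
# The fork at [IUTchIII] Corollary 3.12, L-DH level, READING (P), TAME DATA — the constant is `6·(1 + O(1/l))`:
# `Cor312PerImageAtDatum P l` ⟹ `(1/6 − 2/(l(l+1)))·log q^{∤{2,l}}(λ) ≤ (1 + (4 + 8·d_mod)/l)·(log-diff + log-cond) + 5·log l + 46 + 2·log π`
# (abc-iut cell, crux ThetaPartII = stmt-ABC-19678, registered stub `stub_cor312PerImage` (iii-P); honest-scope record)

Record-only PROOF file (D-0012) of the abc-iut cell (WAVE-3 discharge seat abc-iut-c312-d1, gen 6); TAKES NO SIDE on [IUTchIII]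
Cor. 3.12 or on the (U)/(P) readings, asserts nothing about any point. Sharpening of this seat's
`PointDict.szpiro_of_cor312PerImageAtDatum_tame_linear` (`LDHGenuinePerImageContentfulTame`, coefficient `2 + 8·d_mod/l`): keeping print's
Step (ii) factor `1 + 4/l` ([IUTchIV] Thm. 1.10 proof Step (ii) p. 24) instead of rounding it to `2` on the `L`-term gives

* **`PointDict.szpiro_of_cor312PerImageAtDatum_tame_six`** — at a TAME datum of an admissible `(P, l)`, `l ≥ 7`:
  `Cor22.Cor312PerImageAtDatum P l → (1/6 − 2/(l(l+1)))·log q^{∤{2,l}}(λ) ≤ (1 + (4 + 8·d_mod)/l)·L + 5·log l + 46 + 2·log π`,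
  `L := log-diff + log 𝔣^{∤{2,l}}` — i.e. `log q^{∤{2,l}}(λ) ≤ c(l, d_mod)·L + O(log l)` with
  `c(l,d) = (1 + (4+8d)/l)/(1/6 − 2/(l(l+1)))`: `c(7,1) ≈ 20.7`, `c(11,1) ≈ 13.8`, `c(23,1) ≈ 9.3`, `c(47,1) ≈ 7.6`, **`c(l,d) → 6`**.

READING (statement about OUR typed objects; hypothesis = the disputed crux). Point by point, at tame data, the (P)-line crux IS «Szpiro's
inequality with constant `6·(1 + O(d_mod/l))` and additive term `O(log l)`» for `log q^{∤{2,l}}(λ)` against `log-diff + log-cond` of the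
minimal field of `λ` — the same `6` as in the Vojta/Szpiro form [IUTchIV] Thm. A derives (there with `+ε` bought by `l → ∞`), now visible
at the level of the single disputed inequality rather than after [IUTchIV] §2. For orientation (numbers, not kernel): known Szpiro ratios
reach `≈ 8.8 > 6`, but at conductors far too small for the additive `O(log l) + 46` term (`/ (1/6 − …)`) to be overcome; no known curve
refutes the stub by this route. Neither direction is an in-cell target.
[cite: Mochizuki2012, IUTchIV Thm. 1.10 proof Steps (ii)–(viii) p. 24–30; Thm. A] [claim: Mochizuki2012, status: disputed]. PROOF-ONLY.
-/

noncomputable section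

namespace Summit.ABC.IUTFork

open Literature.IUT.HodgeTheaters Literature.IUT.LogVolume NumberField IsDedekindDomain
open Literature.NumberTheory.DiophantineGeometry.GenEll
open scoped Nat.Prime

namespace PointDict

variable {P : NFPoint} {l : ℕ}

/-- **TAME DATA, SHARP LINEAR FORM — Szpiro with constant `6·(1 + O(1/l))`**: for an admissible `(P, l)`, `l ≥ 7`, a TAME datum `T`
(no wildly ramified support place), `Cor22.Cor312PerImageAtDatum P l` implies
`(1/6 − 2/(l(l+1)))·log q^{∤{2,l}}(λ) ≤ (1 + (4 + 8·d_mod)/l)·(log-diff + log-cond) + 5·log l + 46 + 2·log π`.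
[cite: Mochizuki2012, IUTchIV Thm. 1.10 proof Steps (ii)–(x) p. 24–32] [claim: Mochizuki2012, status: disputed] -/
theorem szpiro_of_cor312PerImageAtDatum_tame_six (hP : P ∈ UP) (h7 : 7 ≤ l) (h : Cor22.Cor312PerImageAtDatum P l)
    (T : Cor22.ThetaVolumeDatumAt P l)
    (htame : letI := T.instFieldF; letI := T.instNumberFieldF; letI := T.instAlgebraF; letI := T.instFieldK
      letI := T.instNumberFieldK; letI := T.instAlgebraK; letI := T.instIsElliptic
      ∀ (p : ℕ) [hp : Fact p.Prime], p ∈ T.I.supportPrimes → ∀ v : placesOver (fieldOfModuli T.E) p,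
        ¬ p - 2 < absRamificationIdx p ((T.I.σ.localFieldFamily p hp.out).k v)) :
    (1 / 6 - 2 / ((l : ℝ) * ((l : ℝ) + 1))) * Cor22.logQAvoid P {2, l} ≤
      (1 + (4 + 8 * (Cor22.dmod P : ℝ)) / l) * (P.logDiff + Cor22.logCondAvoid P {2, l})
        + 5 * Real.log l + 46 + 2 * Real.log Real.pi := by
  have hmain := szpiro_of_cor312PerImageAtDatum_tame hP h7 h T htame
  have hl7 : (7 : ℝ) ≤ l := by exact_mod_cast h7
  have hl0 : (0 : ℝ) < l := by linarith
  have harch : ThetaVolumeInput.archLogTheta l = ((l : ℝ) + 5) / 4 * Real.log Real.pi := rfl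
  rw [harch] at hmain
  set L : ℝ := P.logDiff + Cor22.logCondAvoid P {2, l} with hLdef
  set D : ℝ := (Cor22.dmod P : ℝ) with hDdef
  set X : ℝ := Real.log (2 * 3 * 5 * (l : ℝ)) with hXdef
  have hL0 : 0 ≤ L := add_nonneg P.logDiff_nonneg (Cor22.logCondAvoid_nonneg P _)
  have hD0 : 0 ≤ D := by rw [hDdef]; positivity
  have hlogl : 0 ≤ Real.log l := Real.log_nonneg (by linarith)
  have hpi0 : 0 ≤ Real.log Real.pi := Real.log_nonneg (by linarith [Real.pi_gt_three])
  have hX0 : 0 ≤ X := Real.log_nonneg (by linarith)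
  have hX : X ≤ 4 + Real.log l := by
    have h32 : Real.log (2 * 3 * 5 * (l : ℝ)) ≤ Real.log ((2 : ℝ) ^ 5 * (l : ℝ)) :=
      Real.log_le_log (by positivity) (by nlinarith)
    have e : Real.log ((2 : ℝ) ^ 5 * (l : ℝ)) = 5 * Real.log 2 + Real.log l := by
      rw [Real.log_mul (by norm_num) hl0.ne', Real.log_pow]; push_cast; ring
    rw [e] at h32
    have h2 := Real.log_two_lt_d9
    rw [hXdef]
    linarith
  have h4l : 4 / (l : ℝ) ≤ 1 := by rw [div_le_one hl0]; linarith
  have h4l' : 0 ≤ 4 / (l : ℝ) := by positivity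
  -- (a) keep `(1 + 4/l)` on `L`, round it to `2` only on the constant `2 log l + 21`
  have ha : (1 + 4 / (l : ℝ)) * (L + 2 * Real.log l + 21) ≤ (1 + 4 / (l : ℝ)) * L + 2 * (2 * Real.log l + 21) := by
    have hpos : 0 ≤ 2 * Real.log l + 21 := by positivity
    have e : (1 + 4 / (l : ℝ)) * (L + 2 * Real.log l + 21) = (1 + 4 / (l : ℝ)) * L + (1 + 4 / (l : ℝ)) * (2 * Real.log l + 21) := by
      ring
    rw [e]
    nlinarith
  -- (b) `(4/l)·(2·D·L + X) ≤ (8·D/l)·L + (4 + log l)`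
  have hb : 4 / (l : ℝ) * (2 * D * L + X) ≤ 8 * D / l * L + (4 + Real.log l) := by
    have t : 4 / (l : ℝ) * X ≤ 1 * X := mul_le_mul_of_nonneg_right h4l hX0
    have e : 4 / (l : ℝ) * (2 * D * L + X) = 8 * D / l * L + 4 / (l : ℝ) * X := by ring
    rw [e]; linarith
  have hbr : (1 + 4 / (l : ℝ)) * (L + 2 * Real.log l + 21) + 4 / (l : ℝ) * (2 * D * L + X) ≤
      (1 + (4 + 8 * D) / l) * L + 5 * Real.log l + 46 := by
    have e : (1 + (4 + 8 * D) / l) * L = (1 + 4 / (l : ℝ)) * L + 8 * D / l * L := by ring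
    linarith
  have hc0 : (0 : ℝ) < ((l : ℝ) + 1) / 4 := by positivity
  have hdarch : ((l : ℝ) + 5) / 4 * Real.log Real.pi ≤ ((l : ℝ) + 1) / 4 * (2 * Real.log Real.pi) := by
    have : ((l : ℝ) + 5) / 4 ≤ ((l : ℝ) + 1) / 4 * 2 := by linarith
    calc ((l : ℝ) + 5) / 4 * Real.log Real.pi ≤ ((l : ℝ) + 1) / 4 * 2 * Real.log Real.pi :=
        mul_le_mul_of_nonneg_right this hpi0
      _ = ((l : ℝ) + 1) / 4 * (2 * Real.log Real.pi) := by ring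
  have hQ : 0 ≤ Cor22.logQAvoid P {2, l} := Cor22.logQAvoid_nonneg P _
  have hleft : ((l : ℝ) + 1) / 4 * ((1 / 6 - 2 / ((l : ℝ) * ((l : ℝ) + 1))) * Cor22.logQAvoid P {2, l}) ≤
      (((l : ℝ) + 1) / 24 - 1 / (2 * l)) * Cor22.logQAvoid P {2, l} := by
    have hl1' : (0 : ℝ) < (l : ℝ) + 1 := by linarith
    have e : ((l : ℝ) + 1) / 4 * (1 / 6 - 2 / ((l : ℝ) * ((l : ℝ) + 1))) = ((l : ℝ) + 1) / 24 - 1 / (2 * l) := by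
      field_simp
      ring
    rw [← mul_assoc, e]
  have hR := mul_le_mul_of_nonneg_left hbr hc0.le
  have htot : ((l : ℝ) + 1) / 4 * ((1 / 6 - 2 / ((l : ℝ) * ((l : ℝ) + 1))) * Cor22.logQAvoid P {2, l}) ≤
      ((l : ℝ) + 1) / 4 * ((1 + (4 + 8 * D) / l) * L + 5 * Real.log l + 46 + 2 * Real.log Real.pi) := by
    have e : ((l : ℝ) + 1) / 4 * ((1 + (4 + 8 * D) / l) * L + 5 * Real.log l + 46 + 2 * Real.log Real.pi)
        = ((l : ℝ) + 1) / 4 * ((1 + (4 + 8 * D) / l) * L + 5 * Real.log l + 46)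
          + ((l : ℝ) + 1) / 4 * (2 * Real.log Real.pi) := by ring
    rw [e]
    linarith [hleft, hmain, hR, hdarch]
  exact le_of_mul_le_mul_left htot hc0

end PointDict

end Summit.ABC.IUTFork

end
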